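import Mathlib
import HarnessLib
import Summits.FinalStateConjecture.FinalStateConjecture.Theorems.LogTimeThreeAnnuliDyadicCaptureCaptureUpgrade
import Summits.FinalStateConjecture.FinalStateConjecture.Theorems.LogTimeThreeAnnuliDyadicCaptureHonestRechart

/-!
# Route LogTimeThreeAnnuli · crux `DyadicCapture` (stmt-FinalStateConjecture-17488) · line `registered` —
# skeleton v7, stub F (forward, order two)

Stub `stub_conclOfNormalisedEraTwo` of skeleton v7 of the line `registered` of the crux
`Summit.FinalStateConjecture.FinalStateConjecture.Theses.LogTimeThreeAnnuli.DyadicCapture`: for ONE maximal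
development with complete `𝓘⁺`, a `C⁰`-normalised honest era system whose flat and windowed clauses are stated
at the single order `k = 2` settles as the re-typed Statement demands.

* `captureOrder_main` — the chart-level capture upgrade of `captureC_main` (CaptureUpgradeC) at ONE order `k`:
  a smooth chart on the reference boosted Kerr exterior of `(M', a')`, `0 < M'`, which is `C⁰`-normalised on
  fixed slabs and windowed-close in `Cᵏ` (fixed and growing slab, same member) has `(M', a')` in the window
  and converges to the reference member in `Cᵏ` on fixed and growing slabs. The order-`0` closeness on the
  anchor slab that the capture (`captureA_mem_window`) consumes comes from the order-`k` one by monotonicity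
  in `k` (`captureA_truncDeviationCk_mono_k`); then `captureB_tendsto_fixed`, `captureC_tendsto_growing`.
* `stub_conclOfNormalisedEraTwo` — the stub: hole by hole `captureOrder_main` at `k = 2`
  (`d.background i = boostedKerrBackground Λᵢ cᵢ (d.mass i) (d.spin i)` by `rfl`), sub-extremality
  `|a| ≤ χM < M` from the window (`dyadicCaptureReduction_subextremal_of_window`), the same-parameter rechart
  `QuasiFinalStateDecomposition.toFinalStateDecomposition` (as in `dyadicCapture_honestRechart_of_sameParams`;
  `charted / certifiedLate / certifiedSlab / background / chart / motion / flatChart` agree by `rfl`) and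
  `stub_settledRechart`.

Sources: Kerr–Schild 1965 §2 (the explicit stationary family); Dafermos–Luk arXiv:1710.01722,
Conjecture 1 (b)–(c) (asymptotic stability towards a nearby Kerr in horizon-normalised gauges).
-/

-- the `Summit.FinalStateConjecture.FinalStateConjecture.…` namespace repeats the summit = sub-problem
-- segment (D-0017 layout, CONVENTIONS §2); the duplicate is deliberate.
set_option linter.dupNamespace false

noncomputable section

namespace Summit.FinalStateConjecture.FinalStateConjecture.Theorems

open Literature.Geometry.Lorentzian
open scoped Topology Manifold ENNReal ContDiff
open Filter Set

section Chart

variable {𝓢 : Spacetime.{0} 4} (Λ : lorentzGroup) (c : E4) (M' a' : ℝ)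
  (Ψ : (boostedKerrExterior Λ c M' a') → 𝓢.carrier)

-- long statements; the structure-update backgrounds and the operator-norm instance paths unify slowly
set_option synthInstance.maxHeartbeats 200000 in
set_option maxHeartbeats 3200000 in
/-- **Capture upgrade for one chart at one order.** A smooth chart on the reference boosted Kerr exterior
of `(M', a')`, `0 < M'`, which is `C⁰`-normalised (its `C⁰` distance to the REFERENCE member tends to `0`
on every fixed slab) and windowed-close at the order `k` (for every `ρ, ε`, eventually some member of the
window `m₀ ≤ M ≤ 1/m₀`, `|a| ≤ χM` is `ε`-close in `Cᵏ` on the fixed slab of radius `ρ` and on the growing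
slab of radius `R(τ)`) converges to the reference member in `Cᵏ`, on every fixed slab and on the growing
slabs, and `(M', a')` lies in the window (the order-`0` closeness on the anchor slab used by the capture is
the order-`k` one by monotonicity in `k`). Adapted from `captureC_main`. [cite: KerrSchild1965, §2] -/
theorem captureOrder_main (hΨ : ContMDiff 𝓘(ℝ, E4) (𝓡 4) ∞ Ψ) (hM' : 0 < M') (R : ℝ → ℝ) {m₀ χ : ℝ}
    (hm₀ : 0 < m₀) (k : ℕ)
    (hW : ∀ (ρ : ℝ) (ε : ℝ≥0∞), 0 < ε → ∀ᶠ τ : ℝ in atTop, ∃ M a : ℝ,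
      m₀ ≤ M ∧ M ≤ m₀⁻¹ ∧ |a| ≤ χ * M ∧
      𝓢.truncDeviationCk ({boostedKerrBackground Λ c M' a' with bilin := boostedKerrBilin Λ c M a} : ModelBackground) Ψ k ρ τ ≤ ε ∧
      𝓢.truncDeviationCk ({boostedKerrBackground Λ c M' a' with bilin := boostedKerrBilin Λ c M a} : ModelBackground) Ψ k (R τ) τ ≤ ε)
    (hN : ∀ ρ : ℝ, Tendsto (fun τ : ℝ ↦ 𝓢.truncDeviationCk ({boostedKerrBackground Λ c M' a' with bilin := boostedKerrBilin Λ c M' a'} : ModelBackground) Ψ 0 ρ τ) atTop (𝓝 0)) :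
    (m₀ ≤ M' ∧ M' ≤ m₀⁻¹ ∧ |a'| ≤ χ * M') ∧
      (∀ ρ : ℝ, Tendsto (fun τ : ℝ ↦ 𝓢.truncDeviationCk ({boostedKerrBackground Λ c M' a' with bilin := boostedKerrBilin Λ c M' a'} : ModelBackground) Ψ k ρ τ)
        atTop (𝓝 0)) ∧
      Tendsto (fun τ : ℝ ↦ 𝓢.truncDeviationCk ({boostedKerrBackground Λ c M' a' with bilin := boostedKerrBilin Λ c M' a'} : ModelBackground) Ψ k (R τ) τ)
        atTop (𝓝 0) := by
  -- adapted from `captureC_main` (CaptureUpgradeC), at the single order `k`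
  -- anchor and the basic radius
  obtain ⟨y₀, h0, h1, h2, h3, hy₀⟩ := freezing_exists_anchor M' a'
  -- the fixed part of the windowed closeness
  have hWf : ∀ (ρ : ℝ) (ε : ℝ≥0∞), 0 < ε → ∀ᶠ τ : ℝ in atTop,
      ∃ p ∈ {q : ℝ × ℝ | m₀ ≤ q.1 ∧ q.1 ≤ m₀⁻¹ ∧ |q.2| ≤ χ * q.1}, 𝓢.truncDeviationCk ({boostedKerrBackground Λ c M' a' with bilin := boostedKerrBilin Λ c (Prod.fst p) (Prod.snd p)} : ModelBackground) Ψ k ρ τ ≤ ε := by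
    intro ρ ε hε
    filter_upwards [hW ρ ε hε] with τ hτ
    obtain ⟨M, a, hM1, hM2, ha, hfix, -⟩ := hτ
    exact ⟨(M, a), ⟨hM1, hM2, ha⟩, hfix⟩
  -- the growing part of the windowed closeness
  have hWg : ∀ ε : ℝ≥0∞, 0 < ε → ∀ᶠ τ : ℝ in atTop,
      ∃ p ∈ {q : ℝ × ℝ | m₀ ≤ q.1 ∧ q.1 ≤ m₀⁻¹ ∧ |q.2| ≤ χ * q.1},
        𝓢.truncDeviationCk ({boostedKerrBackground Λ c M' a' with bilin := boostedKerrBilin Λ c (Prod.fst p) (Prod.snd p)} : ModelBackground) Ψ k (R τ) τ ≤ ε := by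
    intro ε hε
    filter_upwards [hW 0 ε hε] with τ hτ
    obtain ⟨M, a, hM1, hM2, ha, -, hgrow⟩ := hτ
    exact ⟨(M, a), ⟨hM1, hM2, ha⟩, hgrow⟩
  -- the order-`0` closeness on the anchor slab, from the order-`k` one by monotonicity in `k`
  have hW0 : ∀ ε : ℝ≥0∞, 0 < ε → ∀ᶠ τ : ℝ in atTop,
      ∃ p ∈ {q : ℝ × ℝ | m₀ ≤ q.1 ∧ q.1 ≤ m₀⁻¹ ∧ |q.2| ≤ χ * q.1}, 𝓢.truncDeviationCk ({boostedKerrBackground Λ c M' a' with bilin := boostedKerrBilin Λ c (Prod.fst p) (Prod.snd p)} : ModelBackground) Ψ 0 (Kerr.radius a' y₀) τ ≤ ε := by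
    intro ε hε
    filter_upwards [hWf (Kerr.radius a' y₀) ε hε] with τ hτ
    obtain ⟨p, hp, hP⟩ := hτ
    exact ⟨p, hp, (captureA_truncDeviationCk_mono_k _ _ (Nat.zero_le k) _ _).trans hP⟩
  -- the reference member lies in the window
  have hpinfW : ((M', a') : ℝ × ℝ) ∈ {q : ℝ × ℝ | m₀ ≤ q.1 ∧ q.1 ≤ m₀⁻¹ ∧ |q.2| ≤ χ * q.1} :=
    captureA_mem_window Λ c M' a' Ψ hM' h0 h1 h2 h3 hy₀ hm₀ hW0 (hN (Kerr.radius a' y₀))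
  -- fixed slabs
  have hfixed : ∀ ρ : ℝ, Tendsto (fun τ : ℝ ↦ 𝓢.truncDeviationCk ({boostedKerrBackground Λ c M' a' with bilin := boostedKerrBilin Λ c M' a'} : ModelBackground) Ψ k ρ τ)
      atTop (𝓝 0) := by
    intro ρ
    have h := captureB_tendsto_fixed Λ c M' a' Ψ hΨ hM' h0 h1 h2 h3 hy₀ hm₀ k
      ((le_max_left _ _).trans (le_max_right ρ (max (Kerr.radius a' y₀) (|χ| * m₀⁻¹ + 1))))
      ((le_max_right _ _).trans (le_max_right ρ (max (Kerr.radius a' y₀) (|χ| * m₀⁻¹ + 1))))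
      (hWf (max ρ (max (Kerr.radius a' y₀) (|χ| * m₀⁻¹ + 1)))) (hN (Kerr.radius a' y₀))
    exact tendsto_of_tendsto_of_tendsto_of_le_of_le tendsto_const_nhds h (fun _ ↦ zero_le)
      fun τ ↦ 𝓢.truncDeviationCk_mono ({boostedKerrBackground Λ c M' a' with bilin := boostedKerrBilin Λ c M' a'} : ModelBackground) Ψ k (le_max_left ρ _) τ
  -- growing slabs
  exact ⟨hpinfW, hfixed, captureC_tendsto_growing Λ c M' a' Ψ hΨ hm₀ hpinfW R k hfixed hWg⟩

end Chart

-- the structure-update backgrounds of the registered signature unfold `d.background i` slowly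
set_option synthInstance.maxHeartbeats 200000 in
set_option maxHeartbeats 3200000 in
/-- **Stub F — forward, order two** (`stub_conclOfNormalisedEraTwo`, skeleton v7 of the line `registered` of the
crux `DyadicCapture`): for ONE maximal development with complete `𝓘⁺`, a `C⁰`-normalised honest era system AT
ORDER TWO settles as the re-typed Statement demands. Hole by hole the capture upgrade at the single order `k = 2`
(`captureOrder_main`; `d.background i = boostedKerrBackground Λᵢ cᵢ (d.mass i) (d.spin i)` by `rfl`) puts the
reference labels in the window — hence sub-extremal, `|a| ≤ χM < M` — and gives `C²` convergence to the reference
member on fixed and growing slabs IN THE SAME CHARTS; so `d' := d.toFinalStateDecomposition h₁ h₂` with `O' := O`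
(`charted`, `certifiedLate`, `certifiedSlab`, `background`, `chart`, `motion`, `flatChart` agree by `rfl`) carries
every hypothesis of `stub_settledRechart` verbatim. [cite: DafermosLuk2017, Conjecture 1 (b)–(c)] -/
theorem stub_conclOfNormalisedEraTwo : ∀ (X : Type) [TopologicalSpace X] [ChartedSpace E3 X] [IsManifold (𝓡 3) ((⊤ : ℕ∞) : WithTop ℕ∞) X] [T2Space X] [SecondCountableTopology X] [ConnectedSpace X], ∀ D ∈ admissibleVacuumData X, ∀ 𝒟 : VacuumCauchyDevelopment D, 𝒟.IsMaximal → Summit.FinalStateConjecture.HasCompleteNullInfinity 𝒟.toCauchyDevelopment → (∃ (m₀ χ : ℝ) (O : Set 𝒟.carrier) (d : QuasiFinalStateDecomposition 𝒟.toSpacetime O 2 ⊤) (R : Fin d.N → ℝ → ℝ), 0 < m₀ ∧ χ < 1 ∧ O = Summit.FinalStateConjecture.exteriorOf 𝒟.toCauchyDevelopment d.charted ∧ Summit.FinalStateConjecture.RaysStayInClosure 𝒟.toCauchyDevelopment O ∧ (∀ i : Fin d.N, Filter.Tendsto (R i) Filter.atTop Filter.atTop ∧ ∀ τ : ℝ,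 max (Kerr.rPlus (d.mass i) (d.spin i)) 0 + 1 ≤ R i τ) ∧ (∀ τ₁ : ℝ, d.τ₀ < τ₁ → O \ d.certifiedLate R τ₁ ⊆ 𝒟.metric.causalPast 𝒟.timeOrientation (d.certifiedSlab R τ₁)) ∧ (∀ i : Fin d.N, Summit.FinalStateConjecture.IsOrthochronous (d.motion i).1) ∧ (∀ (i : Fin d.N) (ρ : ℝ), ∀ᶠ τ in Filter.atTop, ∀ x ∈ (d.background i).truncTimeSlab ρ τ, ∀ w : E4, 𝒟.timeOrientation.IsFutureDirected (mfderiv 𝓘(ℝ, E4) (𝓡 4) (d.chart i) x w) → 0 < ((d.motion i).1 : E4 ≃L[ℝ] E4).symm w 0) ∧ (∀ᶠ τ in Filter.atTop, ∀ x ∈ (Minkowski.backgroundOn d.flatDomain).timeSlab τ, 𝒟.timeOrientation.IsFutureDirected (mfderiv 𝓘(ℝ, E4) (𝓡 4) d.flatChart x (E4.basisVector 0))) ∧ Filter.Tendsto (fun τ => 𝒟.toSpacetime.deviationCk (Minkowski.backgroundOn d.flatDomain) d.flatChart 2 τ) Filter.atTop (nhds 0) ∧ (∀ (i : Fin d.N)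 (ρ : ℝ) (ε : ENNReal), 0 < ε → ∀ᶠ τ in Filter.atTop, ∃ M a : ℝ, m₀ ≤ M ∧ M ≤ m₀⁻¹ ∧ |a| ≤ χ * M ∧ 𝒟.toSpacetime.truncDeviationCk {d.background i with bilin := boostedKerrBilin (d.motion i).1 (d.motion i).2 M a} (d.chart i) 2 ρ τ ≤ ε ∧ 𝒟.toSpacetime.truncDeviationCk {d.background i with bilin := boostedKerrBilin (d.motion i).1 (d.motion i).2 M a} (d.chart i) 2 (R i τ) τ ≤ ε) ∧ (∀ (i : Fin d.N) (ρ : ℝ), Filter.Tendsto (fun τ => 𝒟.toSpacetime.truncDeviationCk {d.background i with bilin := boostedKerrBilin (d.motion i).1 (d.motion i).2 (d.mass i) (d.spin i)} (d.chart i) 0 ρ τ) Filter.atTop (nhds 0))) → (∃ (O' : Set 𝒟.carrier) (d' : FinalStateDecomposition 𝒟.toSpacetime O' 2), (∀ i, Kerr.IsSubextremal (d'.mass i) (d'.spin i)) ∧ O' = Summit.FinalStateConjecture.exteriorOf 𝒟.toCauchyDevelopment d'.charted ∧ Summit.FinalStateConjecture.RaysStayInClosure 𝒟.toCauchyDevelopment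 O' ∧ Summit.FinalStateConjecture.HasExhaustiveCharts d' ∧ Summit.FinalStateConjecture.IsFutureOriented d') := by
  intro X _ _ _ _ _ _ D hD 𝒟 hmax hI hsys
  obtain ⟨m₀, χ, O, d, R, hm₀, hχ, hO, hrays, hR, hexh, horth, hcov, hflat0, hflat2, hW2, hN⟩ := hsys
  -- hole by hole: the capture upgrade at order two, in the reference charts
  have key : ∀ i : Fin d.N, (m₀ ≤ d.mass i ∧ d.mass i ≤ m₀⁻¹ ∧ |d.spin i| ≤ χ * d.mass i) ∧
      (∀ ρ : ℝ, Filter.Tendsto (fun τ => 𝒟.toSpacetime.truncDeviationCk {d.background i with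
        bilin := boostedKerrBilin (d.motion i).1 (d.motion i).2 (d.mass i) (d.spin i)} (d.chart i) 2 ρ τ)
        Filter.atTop (nhds 0)) ∧
      Filter.Tendsto (fun τ => 𝒟.toSpacetime.truncDeviationCk {d.background i with
        bilin := boostedKerrBilin (d.motion i).1 (d.motion i).2 (d.mass i) (d.spin i)} (d.chart i) 2 (R i τ) τ)
        Filter.atTop (nhds 0) := by
    intro i
    have hWi := hW2 i
    have hNi := hN i
    unfold QuasiFinalStateDecomposition.background at hWi hNi ⊢
    exact captureOrder_main (d.motion i).1 (d.motion i).2 (d.mass i) (d.spin i) (d.chart i)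
      (d.isLateChart i).contMDiff (d.mass_pos i) (R i) hm₀ 2 hWi hNi
  -- the window backgrounds at the reference parameters are the reference backgrounds
  simp only [QuasiFinalStateDecomposition.background_with_bilin_self] at key
  -- sub-extremality from the window
  have hsub : ∀ i : Fin d.N, |d.spin i| < d.mass i := fun i =>
    (dyadicCaptureReduction_subextremal_of_window hm₀ hχ (key i).1.1 (key i).1.2.2).2
  -- the two convergence fields of `FinalStateDecomposition`, in the same charts, at `k = 2`
  have h₁ : ∀ (i : Fin d.N) (ρ : ℝ), Tendsto
      (fun τ => 𝒟.toSpacetime.truncDeviationCk (d.background i) (d.chart i) 2 ρ τ) atTop (𝓝 0) :=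
    fun i ρ => (key i).2.1 ρ
  -- the settled rechart: `O' := O`, `d' := d.toFinalStateDecomposition h₁ hflat2` (same charts, by `rfl`)
  exact stub_settledRechart X D hD 𝒟 hmax hI O (d.toFinalStateDecomposition h₁ hflat2) (fun i => hsub i)
    hO hrays ⟨R, hR, fun i => (key i).2.2, hexh⟩ horth hcov hflat0

end Summit.FinalStateConjecture.FinalStateConjecture.Theorems

end
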